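import Summits.NavierStokesRegularity.FluidComputer.ClayBlowupSingularSliceAxis
import Literature.Analysis.FluidPDE.ClassicalContinuationAPriori
import Literature.Analysis.FluidPDE.LerayLocalRegularH1Proofs
import Literature.Analysis.FluidPDE.NSWeakStrongUniquenessHolds
import Literature.Analysis.FluidPDE.NSCriticalClosureTao
import Literature.Analysis.FluidPDE.NSLerayStrongLocalExistence
import Literature.Analysis.FluidPDE.KNSSNoAxisymmetricTypeIHolds
import HarnessLib

/-!
# THE LERAY–HOPF COMPLETION OF AN UNFORCED CLAY BLOW-UP AT ITS LIFESPAN, and the KNSS row: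
# AN UNFORCED AXISYMMETRIC CLAY BLOW-UP IS TYPE II

Cell `ns-blowup`, seat `ns-blowup-ecbridge-2` (g7; the E–C endpoint theory seat). LABEL: E–C typing,
(A)-side (KERNEL — no named fact). WHAT THIS IS NOT: not Navier–Stokes evidence — necessary conditions on
the TYPE `ClayBlowup ν` with zero force, whose inhabitants would be exactly the counterexamples to
Fefferman's (A) (`navierStokesRegularity_iff_forall_clayBlowup_force_ne_zero`); none is claimed.
Companion memo: `run/shared/lean/pub/ns-blowup/ecbridge2/ECBRIDGE-2-MEMO-6.md` §4 (iv).

## Content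

MEMO-5 §4 (iv) asked for `IsLerayHopfOn` on the CLOSED lifespan `[0, T]` of a Clay blow-up (the type
only knows a classical solution on `[0, T)`; the slice `u T` is junk), which the tree's
`knss_no_axisymmetric_typeI_holds` (Koch–Nadirashvili–Seregin–Šverák 2009, Thms. 6.1–6.2, proved in
the tree) takes as a hypothesis. For an UNFORCED Clay blow-up it is supplied by weak–strong uniqueness,
with no weak-limit construction:

* `ClayBlowup.isLerayHopfOn_of_lt` — `u` is Leray–Hopf on `[0, T')` for every `T' < T` (Tao 2013,
  Lemma 8.1: `isLerayHopfOn_of_finiteEnergy` on the closed sub-slabs of the type);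
* `ClayBlowup.ae_eq_of_isLerayHopfOn` — every Leray–Hopf solution from `u 0` agrees with `u` a.e. at
  every `t ∈ (0, T']`, `T' < T` (Prodi–Serrin weak–strong uniqueness at `q = r = ∞`,
  `weak_strong_uniqueness_holds`; `u` is bounded on `[0, T']`, `exists_norm_le`);
* **`ClayBlowup.exists_lerayHopf_completion`** — there is a GLOBAL Leray–Hopf weak solution `v` from
  `u 0` with `v = u` on `[0, T)` POINTWISE: the global weak continuation `w` of `u|[0,T/2]` (Leray's
  existence theorem from the slice `u(T/2)` and concatenation,
  `IsLerayHopfOn.exists_isGlobalLerayHopf_extension_le`) agrees with `u` a.e. on every slice before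
  `T`, so `v := u` on `[0, T)`, `:= w` from `T` on, is Leray–Hopf (`IsLerayHopfOn.congr_ae_slices`);
  in particular `v` is `IsLerayHopfOn T ν 0 (u 0)` — the completion at the lifespan;
* **`ClayBlowup.not_typeI_of_isAxisymmetric`** — THE KNSS ROW: an unforced Clay blow-up with
  AXISYMMETRIC datum (swirl allowed) satisfies NEITHER `|u(t, x)| ≤ C/√(T - t)` near `T`
  (`¬ IsTypeIBlowup u T`) NOR `r |u(t, x)| ≤ C` on `[0, T) × ℝ³`: by `knss_no_axisymmetric_typeI_holds`
  applied to the completion `v` (classical on `[0, T)` = `u`; Leray–Hopf on `[0, T]`; bounded on every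
  `[0, T']`; axisymmetric by `ClayBlowup.isAxisymmetric`) either bound would continue `v`, hence `u`,
  classically past `T`, against `not_hasSmoothExtensionPast`;
* `ClayBlowup.axisymmetric_portrait_of_force_eq_zero` — summary: an unforced axisymmetric Clay blow-up
  is TYPE II in both senses AND blows up first on a nonempty compact `ℋ¹`-null subset of the axis
  (`exists_singularPoint_on_axis`); the `DesignedBlowup` twins; and the (A)-reading
  `not_navierStokesRegularity_axisymmetric_witness_is_typeII`.

References: H. Koch, N. Nadirashvili, G. Seregin, V. Šverák, Acta Math. 203 (2009), Thms. 6.1–6.2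
[cite: KochNadirashviliSereginSverak2009, Thm 6.1 and Thm 6.2]; G. Seregin, V. Šverák, Comm. PDE 34
(2009), Thms. 1.1–1.2 [cite: SereginSverak2009, Thm 1.1]; J. Leray, Acta Math. 63 (1934), §31–§33
[cite: Leray1934, §33]; T. Tao, Anal. PDE 6 (2013), Lemma 8.1 [cite: Tao2011, Lemma 8.1];
J. C. Robinson, J. L. Rodrigo, W. Sadowski, CUP 2016, Thm. 8.19 [cite: RobinsonRodrigoSadowski2016, Thm. 8.19];
C. L. Fefferman, Clay problem description, (A) [cite: FeffermanClay2006, (A)].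
-/

noncomputable section

namespace Summit.NavierStokesRegularity.FluidComputer

open Set MeasureTheory Filter Topology Function TopologicalSpace Metric
open scoped ENNReal NNReal
open Literature.Analysis.FluidPDE
open Summit.NavierStokesRegularity.NavierStokesRegularity
open Summit.NavierStokesRegularity.FluidComputer.PalasekTowerClayBridge

namespace ClayBlowup

variable {ν : ℝ} (X : ClayBlowup ν)

/-! ## §1 Leray–Hopf on the sub-slabs and weak–strong uniqueness -/

/-- **An unforced Clay blow-up is Leray–Hopf on `[0, T')` for every `0 < T' < T`** (Tao 2013,
Lemma 8.1 on the closed sub-slab `[0, T']`, where the type is a finite-energy classical solution).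
[cite: Tao2011, Lemma 8.1] -/
theorem isLerayHopfOn_of_lt (hν : 0 < ν) (hf : X.f = 0) {T' : ℝ} (hT'0 : 0 < T') (hT' : T' < X.T) :
    IsLerayHopfOn T' ν 0 (X.u 0) X.u := by
  have hcl := X.classical_Icc hT'0 hT'
  rw [hf] at hcl
  obtain ⟨E, hEt, hE⟩ := X.energy T' hT'
  exact (isLerayHopfOn_of_finiteEnergy hcl hν hT'0 ⟨E, hEt, hE⟩).1

/-- **Weak–strong uniqueness below the lifespan**: every Leray–Hopf weak solution `w` on `[0, T')`,
`0 < T' < T`, from the datum `u 0` of an unforced Clay blow-up agrees with `u` almost everywhere at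
every `t ∈ (0, T']` (Prodi–Serrin at `q = r = ∞`: `u` is bounded on `[0, T']`).
[cite: RobinsonRodrigoSadowski2016, Thm. 8.19] [cite: Leray1934, §33] -/
theorem ae_eq_of_isLerayHopfOn (hν : 0 < ν) (hf : X.f = 0) {T' : ℝ} (hT'0 : 0 < T') (hT' : T' < X.T)
    {w : ℝ → EuclideanSpace ℝ (Fin 3) → EuclideanSpace ℝ (Fin 3)} (hw : IsLerayHopfOn T' ν 0 (X.u 0) w) :
    ∀ t ∈ Ioc 0 T', w t =ᵐ[volume] X.u t := by
  have hLH := X.isLerayHopfOn_of_lt hν hf hT'0 hT'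
  obtain ⟨B, hB⟩ := X.exists_norm_le hν hT'
  have hB0 : 0 ≤ B := (norm_nonneg _).trans (hB 0 ⟨le_rfl, hT'0.le⟩ 0)
  have hS : MemLqLp ⊤ ⊤ X.u (Ioo 0 T') :=
    memLqLp_top_top_of_forall_norm_le measurableSet_Ioo hB0
      (fun t ht => (X.classical.contDiff_velocity ⟨ht.1.le, ht.2.trans hT'⟩).continuous)
      (fun t ht x => hB t ⟨ht.1.le, ht.2.le⟩ x)
  have hr : (3 : ℝ≥0∞) < ⊤ := by simp
  have hqr : (2 : ℝ≥0∞) / ⊤ + 3 / ⊤ ≤ 1 := by simp [ENNReal.div_top]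
  exact weak_strong_uniqueness_holds hν hT'0 hLH hr hqr hS hw

/-! ## §2 The Leray–Hopf completion at the lifespan -/

/-- **THE LERAY–HOPF COMPLETION OF AN UNFORCED CLAY BLOW-UP.** For an unforced Clay blow-up at `ν > 0`
there is a GLOBAL Leray–Hopf weak solution `v` from `u 0` which coincides with `u` on `[0, T)`
pointwise; in particular `v` is Leray–Hopf on the CLOSED lifespan `[0, T]` with `v = u` below `T`
(its slice `v T` is the Leray–Hopf value the type does not carry). Construction: the global weak
continuation `w` of `u|[0, T/2]` (`IsLerayHopfOn.exists_isGlobalLerayHopf_extension_le`: Leray's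
existence theorem from `u(T/2)` and concatenation; `w = u` on `[0, T/2]`, in particular `w 0 = u 0`)
agrees with `u` a.e. on every slice `t < T` (`ae_eq_of_isLerayHopfOn`), so `v := u` on `t < T`,
`:= w` on `t ≥ T` is Leray–Hopf on every `[0, T₁)` (`IsLerayHopfOn.congr_ae_slices`). No named fact.
[cite: Leray1934, §31–§33] [cite: RobinsonRodrigoSadowski2016, Thm. 8.19] -/
theorem exists_lerayHopf_completion (hν : 0 < ν) (hf : X.f = 0) :
    ∃ v : ℝ → EuclideanSpace ℝ (Fin 3) → EuclideanSpace ℝ (Fin 3),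
      (∀ t ∈ Ico 0 X.T, v t = X.u t) ∧ (∀ t < X.T, v t = X.u t) ∧
        IsGlobalLerayHopf ν 0 (X.u 0) v := by
  have hT := X.T_pos
  have hLH₂ := X.isLerayHopfOn_of_lt hν hf (half_pos hT) (half_lt_self hT)
  obtain ⟨w, hw, hwu⟩ := hLH₂.exists_isGlobalLerayHopf_extension_le hν (half_pos hT)
  set v : ℝ → EuclideanSpace ℝ (Fin 3) → EuclideanSpace ℝ (Fin 3) :=
    fun t => if t < X.T then X.u t else w t with hvdef
  have hvu : ∀ t < X.T, v t = X.u t := fun t ht => if_pos ht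
  -- every slice of `v` is a.e. the slice of `w`
  have hvw : ∀ t, v t =ᵐ[volume] w t := by
    intro t
    by_cases htT : t < X.T
    · rw [hvu t htT]
      rcases le_or_gt t 0 with ht0 | ht0
      · rw [hwu t (by linarith)]
      · -- weak–strong uniqueness on `[0, (t + T)/2]`
        have h1 : 0 < (t + X.T) / 2 := by positivity
        have h2 : (t + X.T) / 2 < X.T := by linarith
        exact (X.ae_eq_of_isLerayHopfOn hν hf h1 h2 (hw _ h1) t ⟨ht0, by linarith⟩).symm
    · rw [show v t = w t from if_neg htT]
  refine ⟨v, fun t ht => hvu t ht.2, hvu, fun T₁ hT₁ => ?_⟩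
  have hwT := hw T₁ hT₁
  -- joint measurability of `v` on `(0, T₁) × ℝ³`: piecewise of `u` (continuous on `[0, T) × ℝ³`)
  -- and `w` (measurable)
  have hvm : AEStronglyMeasurable (uncurry v) (volume.restrict (Ioo 0 T₁ ×ˢ univ)) := by
    set A : Set (ℝ × EuclideanSpace ℝ (Fin 3)) := {z | z.1 < X.T} with hA
    have hAm : MeasurableSet A := measurableSet_lt measurable_fst measurable_const
    have epw : uncurry v = A.piecewise (uncurry X.u) (uncurry w) := by
      funext z
      by_cases hz : z ∈ A
      · rw [Set.piecewise_eq_of_mem _ _ _ hz]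
        show v z.1 z.2 = X.u z.1 z.2
        rw [hvu z.1 hz]
      · rw [Set.piecewise_eq_of_notMem _ _ _ hz]
        show v z.1 z.2 = w z.1 z.2
        have : ¬ z.1 < X.T := hz
        rw [show v z.1 = w z.1 from if_neg this]
    rw [epw]
    refine AEStronglyMeasurable.piecewise hAm ?_ ?_
    · -- `u` is continuous on `(0, T₁) × ℝ³ ∩ {t < T} ⊆ [0, T) × ℝ³`
      rw [Measure.restrict_restrict hAm]
      have hsub : A ∩ Ioo 0 T₁ ×ˢ (univ : Set (EuclideanSpace ℝ (Fin 3))) ⊆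
          Ico 0 X.T ×ˢ (univ : Set (EuclideanSpace ℝ (Fin 3))) :=
        fun z hz => ⟨⟨hz.2.1.1.le, hz.1⟩, mem_univ _⟩
      have hmeasS : MeasurableSet (A ∩ Ioo 0 T₁ ×ˢ (univ : Set (EuclideanSpace ℝ (Fin 3)))) :=
        hAm.inter (measurableSet_Ioo.prod MeasurableSet.univ)
      exact (X.classical.smooth_velocity.continuousOn.mono hsub).aestronglyMeasurable hmeasS
    · exact hwT.weak.1.mono_measure Measure.restrict_le_self
  exact hwT.congr_ae_slices hT₁ hvm fun t _ => hvw t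

/-- **The completion is Leray–Hopf on the closed lifespan** (the form consumed by
`knss_no_axisymmetric_typeI`): `∃ v, v = u on [0, T) ∧ IsLerayHopfOn T ν 0 (u 0) v`.
[cite: Leray1934, §31–§33] -/
theorem exists_isLerayHopfOn_lifespan (hν : 0 < ν) (hf : X.f = 0) :
    ∃ v : ℝ → EuclideanSpace ℝ (Fin 3) → EuclideanSpace ℝ (Fin 3),
      (∀ t ∈ Ico 0 X.T, v t = X.u t) ∧ IsLerayHopfOn X.T ν 0 (X.u 0) v := by
  obtain ⟨v, hvu, -, hv⟩ := X.exists_lerayHopf_completion hν hf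
  exact ⟨v, hvu, hv X.T X.T_pos⟩

/-! ## §3 The KNSS row: an unforced axisymmetric Clay blow-up is Type II -/

/-- The zero force is axisymmetric. [folklore] -/
theorem isAxisymmetric_zero_force :
    IsAxisymmetric (fun _ : EuclideanSpace ℝ (Fin 3) => (0 : EuclideanSpace ℝ (Fin 3))) := by
  intro θ x
  change (0 : EuclideanSpace ℝ (Fin 3)) = rotZ θ 0
  rw [← rotZLIE_apply, map_zero]

/-- **AN UNFORCED AXISYMMETRIC CLAY BLOW-UP IS TYPE II** (Koch–Nadirashvili–Seregin–Šverák 2009,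
Thms. 6.1–6.2 / Seregin–Šverák 2009, on the type): for a Clay blow-up at `ν > 0` with zero force and
axisymmetric datum (swirl allowed), NEITHER the Type I bound `|u(t, x)| ≤ C/√(T - t)` near `T`
(`IsTypeIBlowup u T`) NOR the bound `r |u(t, x)| ≤ C` on `[0, T) × ℝ³` holds. Proof: the tree theorem
`knss_no_axisymmetric_typeI_holds` applied to the Leray–Hopf completion `v` (`exists_isLerayHopfOn_lifespan`;
`v` is classical on `[0, T)` because it IS `u` there, `IsClassicalNSSolutionOn.congr_velocity`; bounded
on every `[0, T']`, `exists_norm_le`; axisymmetric, `ClayBlowup.isAxisymmetric`) would continue `v`,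
hence `u`, classically past `T` — against `not_hasSmoothExtensionPast`. No named fact.
[cite: KochNadirashviliSereginSverak2009, Thm 6.1 and Thm 6.2] [cite: SereginSverak2009, Thm 1.1 and Thm 1.2] -/
theorem not_typeI_of_isAxisymmetric (hν : 0 < ν) (hf : X.f = 0) (h0A : IsAxisymmetric (X.u 0)) :
    ¬ IsTypeIBlowup X.u X.T ∧
      ¬ ∃ C : ℝ, ∀ t ∈ Ico 0 X.T, ∀ x : EuclideanSpace ℝ (Fin 3), cylRadius x * ‖X.u t x‖ ≤ C := by
  have hT := X.T_pos
  obtain ⟨v, hvu, hv⟩ := X.exists_isLerayHopfOn_lifespan hν hf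
  -- `v` is the classical solution `u` on `[0, T)`
  have hcl : IsClassicalNSSolutionOn (Ico 0 X.T) ν 0 v X.p := by
    have h := X.classical
    rw [hf] at h
    exact h.congr_velocity hvu
  have hv0 : v 0 = X.u 0 := hvu 0 ⟨le_rfl, hT⟩
  have hLH : IsLerayHopfOn X.T ν 0 (v 0) v := by
    rw [hv0]
    exact hv
  have hbdd : ∀ T' < X.T, ∃ M : ℝ, ∀ t ∈ Icc 0 T', ∀ x, ‖v t x‖ ≤ M := by
    intro T' hT'
    obtain ⟨B, hB⟩ := X.exists_norm_le hν hT'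
    exact ⟨B, fun t ht x => by rw [hvu t ⟨ht.1, ht.2.trans_lt hT'⟩]; exact hB t ht x⟩
  have hfA : ∀ t ∈ Ico 0 X.T, IsAxisymmetric (X.f t) := fun t _ => by
    rw [hf]
    exact isAxisymmetric_zero_force
  have hax : ∀ t ∈ Ico 0 X.T, IsAxisymmetric (v t) := fun t ht => by
    rw [hvu t ht]
    exact X.isAxisymmetric hν h0A hfA t ht
  -- either bound continues `v`, hence `u`, past `T`
  have key : ¬ (IsTypeIBlowup v X.T ∨
      ∃ C : ℝ, ∀ t ∈ Ico 0 X.T, ∀ x : EuclideanSpace ℝ (Fin 3), cylRadius x * ‖v t x‖ ≤ C) := by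
    intro halt
    obtain ⟨T', hT', u', p', hcl', hu'⟩ := knss_no_axisymmetric_typeI_holds hν hT hcl hLH hbdd hax halt
    have hext : HasSmoothExtensionPast ν X.f X.u X.T := by
      rw [hf]
      exact ⟨T', hT', u', p', hcl', fun t ht => (hu' t ht).trans (hvu t ht)⟩
    exact X.not_hasSmoothExtensionPast hν hext
  constructor
  · rintro ⟨C, hC⟩
    refine key (Or.inl ⟨C, ?_⟩)
    filter_upwards [hC, Ico_mem_nhdsLT hT] with t ht htI
    rw [hvu t htI]
    exact ht
  · rintro ⟨C, hC⟩
    exact key (Or.inr ⟨C, fun t ht x => by rw [hvu t ht]; exact hC t ht x⟩)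

/-- **PORTRAIT OF AN UNFORCED AXISYMMETRIC CLAY BLOW-UP** (`ν > 0`, zero force, axisymmetric datum):
it is Type II in both senses of Koch–Nadirashvili–Seregin–Šverák (`not_typeI_of_isAxisymmetric`), and it
blows up for the first time exactly on a nonempty compact `ℋ¹`-null subset of the symmetry axis inside
the far-field ball (`exists_singularPoint_on_axis`), every off-axis point staying bounded on a backward
cylinder reaching `T`. No named fact. [cite: KochNadirashviliSereginSverak2009, Thm 6.1 and Thm 6.2]
[cite: CaffarelliKohnNirenberg1982, Theorem B (§6, p. 807)] -/
theorem axisymmetric_portrait_of_force_eq_zero (hν : 0 < ν) (hf : X.f = 0)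
    (h0A : IsAxisymmetric (X.u 0)) :
    (¬ IsTypeIBlowup X.u X.T ∧
      ¬ ∃ C : ℝ, ∀ t ∈ Ico 0 X.T, ∀ x : EuclideanSpace ℝ (Fin 3), cylRadius x * ‖X.u t x‖ ≤ C) ∧
    (∃ R : ℝ, (∀ x₀ : EuclideanSpace ℝ (Fin 3), R < ‖x₀‖ → IsBackwardBoundedAt X.u X.T x₀) ∧
      ∃ x₀ : EuclideanSpace ℝ (Fin 3), ‖x₀‖ ≤ R ∧ cylRadius x₀ = 0 ∧
        ¬ IsBackwardBoundedAt X.u X.T x₀) ∧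
    IsCompact {x₀ : EuclideanSpace ℝ (Fin 3) | ¬ IsBackwardBoundedAt X.u X.T x₀} ∧
      {x₀ : EuclideanSpace ℝ (Fin 3) | ¬ IsBackwardBoundedAt X.u X.T x₀} ⊆
        {x : EuclideanSpace ℝ (Fin 3) | cylRadius x = 0} ∧
      μH[1] {x₀ : EuclideanSpace ℝ (Fin 3) | ¬ IsBackwardBoundedAt X.u X.T x₀} = 0 := by
  have hfA : ∀ t ∈ Ico 0 X.T, IsAxisymmetric (X.f t) := fun t _ => by
    rw [hf]
    exact isAxisymmetric_zero_force
  exact ⟨X.not_typeI_of_isAxisymmetric hν hf h0A, X.exists_singularPoint_on_axis hν h0A hfA⟩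

end ClayBlowup

namespace DesignedBlowup

variable {ν : ℝ} (D : DesignedBlowup ν)

/-- **The Leray–Hopf completion of an unforced designed blow-up** (`ν > 0`; `toClayBlowup`): a global
Leray–Hopf weak solution from `u 0` equal to `u` on `[0, T)`. [cite: Leray1934, §31–§33] -/
theorem exists_lerayHopf_completion (hν : 0 < ν) (hf : D.f = 0) :
    ∃ v : ℝ → EuclideanSpace ℝ (Fin 3) → EuclideanSpace ℝ (Fin 3),
      (∀ t ∈ Ico 0 D.T, v t = D.u t) ∧ (∀ t < D.T, v t = D.u t) ∧ IsGlobalLerayHopf ν 0 (D.u 0) v :=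
  D.toClayBlowup.exists_lerayHopf_completion hν hf

/-- **An unforced axisymmetric designed blow-up is Type II** (`ν > 0`; `toClayBlowup`).
[cite: KochNadirashviliSereginSverak2009, Thm 6.1 and Thm 6.2] -/
theorem not_typeI_of_isAxisymmetric (hν : 0 < ν) (hf : D.f = 0) (h0A : IsAxisymmetric (D.u 0)) :
    ¬ IsTypeIBlowup D.u D.T ∧
      ¬ ∃ C : ℝ, ∀ t ∈ Ico 0 D.T, ∀ x : EuclideanSpace ℝ (Fin 3), cylRadius x * ‖D.u t x‖ ≤ C :=
  D.toClayBlowup.not_typeI_of_isAxisymmetric hν hf h0A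

end DesignedBlowup

/-! ## §4 The (A)-side reading -/

/-- **IF CLAY (A) FAILS FOR AN AXISYMMETRIC DATUM, IT FAILS TYPE II AND ON THE AXIS**: every unforced
Clay blow-up with axisymmetric datum, at any `ν > 0`, escapes both Koch–Nadirashvili–Seregin–Šverák
bounds and has its nonempty compact `ℋ¹`-null singular slice on the symmetry axis. (By g5/g6,
`¬ NavierStokesRegularity` is equivalent to the existence of an unforced Clay blow-up; nothing here
asserts that one exists.) [cite: KochNadirashviliSereginSverak2009, Thm 6.1 and Thm 6.2]
[cite: FeffermanClay2006, (A)] -/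
theorem unforced_axisymmetric_clayBlowup_is_typeII_on_axis {ν : ℝ} (hν : 0 < ν) (X : ClayBlowup ν)
    (hf : X.f = 0) (h0A : IsAxisymmetric (X.u 0)) :
    ¬ IsTypeIBlowup X.u X.T ∧
      (¬ ∃ C : ℝ, ∀ t ∈ Ico 0 X.T, ∀ x : EuclideanSpace ℝ (Fin 3), cylRadius x * ‖X.u t x‖ ≤ C) ∧
      {x₀ : EuclideanSpace ℝ (Fin 3) | ¬ IsBackwardBoundedAt X.u X.T x₀}.Nonempty ∧
      {x₀ : EuclideanSpace ℝ (Fin 3) | ¬ IsBackwardBoundedAt X.u X.T x₀} ⊆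
        {x : EuclideanSpace ℝ (Fin 3) | cylRadius x = 0} ∧
      μH[1] {x₀ : EuclideanSpace ℝ (Fin 3) | ¬ IsBackwardBoundedAt X.u X.T x₀} = 0 := by
  have hfA : ∀ t ∈ Ico 0 X.T, IsAxisymmetric (X.f t) := fun t _ => by
    rw [hf]
    exact ClayBlowup.isAxisymmetric_zero_force
  obtain ⟨h1, h2⟩ := X.not_typeI_of_isAxisymmetric hν hf h0A
  exact ⟨h1, h2, (X.isCompact_singularSlice hν).2, X.singularSlice_subset_axis hν h0A hfA,
    X.hausdorffMeasure_one_singularSlice_eq_zero hν⟩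

end Summit.NavierStokesRegularity.FluidComputer

end
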